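import Summits.QuantumFields.BalabanUV.T4Continuum.Support.NE7ApeTrivialFlatEndDischarged
import Summits.QuantumFields.BalabanUV.T4Continuum.Spine.NE3.PairLandauB8
import HarnessLib

/-!
# NE7ApeTrivialFlatEndWitness — NON-VACUITY CERTIFICATE for the (APE) END at the trivial flat datum: every binder of (155)
# `NE7ApeTrivialFlatEndDischarged.smallField_of_trivialLetters_final` is instantiated SIMULTANEOUSLY (at `U = 1`, `u₀ = 1`, `A₀ = 0`, all currencies `0`),
# and row NE3's shape `LandauRepB8` (G5's one Bałaban binder) holds at the flat pair

Cell `pub-balaban`, rung (B)+1 sub-cell t4, lineage `b2b-balaban-t4-ne7-p1`, generation 72 (CRUX PROVER NE7 #1, OWNER row NE7).  File W1 — the non-vacuity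
check the NE7 desk runs on every END edition (PRICING-NE7: F54a∕b's all-complex binder `hG` was UNSATISFIABLE, witness `i·X_w`, desk E-62-1∕E-75-4; the repaired
ENDs F55a∕b → (152) → (155) replaced it by the skew slice and then DISCHARGED it).  For (155)'s `…_final` the question «is the hypothesis SET jointly
satisfiable, or is the END vacuous?» is answered here by the kernel: YES — the flat configuration with the trivial gauge and the zero representative meets
every one of the 31 binders at once (§1 lists the ten non-numeric ones as a conjunction; §2 feeds all 31 to `…_final` and records the instance of its
conclusion; §3 is the same certificate for the ONE Bałaban binder of G5 `NE7ApeTrivialFlatEndLandauRep.smallField_of_landauRepB8`, row NE3's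
`Spine.NE3.PairLandauB8.LandauRepB8 L N j 1 1 1 0 0 0 β`, cf. NE3's own `pairLandauGaugeB8_flat`).
HONEST FRAMING (page 1): a SATISFIABILITY certificate at ONE point (the flat configuration) — it shows the END is not vacuous; it does NOT discharge any
binder for a non-flat `U` ([B8] Theorem 2 (i)'s output `(u₀, A₀)` for tangent-critical admissible `U` remains a TYPE, NOT in the tree; tangent-criticality
and the numeric lines remain displayed hypotheses of the END); (APE) NOT proved unconditionally; NOT ONE-STEP, NOT NE7; spine 0∕9; finite T⁴ rung (B)+1 —
NOT infinite volume, NOT mass gap, NOT Clay.  Continuum YM on T⁴ ⇐ BetaPertH ∧ nine spine estimates (0/9 proved); BetaPertH ⇐ (D1) ∧ (D4) ∧ CAP+tail;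
G-an2-4 gates asym, D1 and NE2/3/4.  [folklore]; 0 def, 0 sorry; dimension `d + 1 ≥ 2`, `n : Type`.
-/

set_option autoImplicit false

open scoped BigOperators Matrix.Norms.L2Operator
open NormedSpace Finset

namespace Summit.QuantumFields.BalabanUV.T4Continuum.NE7ApeTrivialFlatEndWitness

open Literature.MathematicalPhysics.QuantumFieldTheory.Balaban1983to89
open B7Prop1Explicit B7Prop2Explicit MatrixLog UnitaryModel
open T4AveragingDeficitWall (IsUnitaryCfg IsSkewDir SmallField vary curlAt dirL1 Ad vary_zero_dir)
open T4AveragingDeficitWallBoundary (IsPeriodicCfg periodBox)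
open AveragingDeficitPeriodicCounting (IsPeriodicDir isPeriodicDir_zero)
open AveragingDeficitMultiLevelPrep (cavgIter LevelSmall)
open MinimalActionLevels (perWin)
open BlockAveragePushDirSplit (flat)
open BlockAverageVaryHolo (nbRad)
open BlockAverageVaryDisc (rho0)
open B4Sect5Proof (latticeConst)
open B5Hk163Strip (kappa163)
open B5Hk163TorusHolderDecay (CdecD)
open NE3HessForm (hess dAction)
open NE3TangentCovariantTower (dirIter cavgIter_flat)
open NE3QbarIterCovLiftPrep (cruxC)
open NE3RightInverseSolveLetters (thetaLoc)
open NE3HatInvCurlLetters (curl1C)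
open NE3EnergyShapes (IsUnitarySite IsPeriodicSite gaugeAct_one)
open NE3FramePotBound (isUnitaryCfg_flat)
open NE7CoarseCurvatureLetter (levelSmall_zero)
open NE7ExpansionSegmentLetters (smallField_flat_zero)
open NE7OneStepOfPathOpen (dAction_eq_zero_of_flat)
open NE3.PairLandauB8 (LandauRepB8 isLandauB8_zero covLapDir_zero)
open NE7ApeTrivialFlatEndDischarged (smallField_of_trivialLetters_final)

noncomputable section

variable {d : ℕ}

/-! ## §1 The ten non-numeric binders of (155) `…_final`, at the flat configuration with the trivial gauge and the zero representative -/

/-- **THE NON-NUMERIC BINDERS OF THE END HOLD AT `(U, u₀, A₀) = (1, 1, 0)`**: unitary class datum, level-smallness at radius `0`, plaquette radius `0`,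
TANGENT-CRITICALITY (a flat unitary configuration is critical for every skew direction), the FIBRE CONSTRAINT `cavgIter L (k+1) 1 = 1`, the gauge `u₀ = 1` is
unitary and periodic, [B8] Theorem 2 (i)'s representation `1^{1} = 1·e^{0}`, the representative `A₀ = 0` is periodic with sup `≤ 0` and differences `≤ 0`.
[folklore] -/
theorem final_binders_at_flat {n : Type} [Fintype n] [DecidableEq n] [Nonempty n] (L N k : ℕ) :
    IsUnitaryCfg (flat (d := d + 1) (n := n)) ∧ LevelSmall (d + 1) L k 0 ∧ SmallField (flat (d := d + 1) (n := n)) 0 ∧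
    (∀ φ : Site (d + 1) → Fin (d + 1) → Matrix n n ℂ, IsSkewDir φ → IsPeriodicDir φ ((L ^ (k + 1) * N : ℕ) : ℤ) →
      dirIter L (k + 1) (flat (d := d + 1) (n := n)) φ = 0 → dAction (flat (d := d + 1) (n := n)) φ (perWin (d + 1) (L ^ (k + 1) * N)) = 0) ∧
    cavgIter L (k + 1) (flat (d := d + 1) (n := n)) = flat ∧
    IsUnitarySite (fun _ : Site (d + 1) => (1 : (Matrix n n ℂ)ˣ)) ∧
    (∀ (y : Site (d + 1)) (i : Fin (d + 1)),
      (fun _ : Site (d + 1) => (1 : (Matrix n n ℂ)ˣ)) (y + (((L ^ (k + 1) * N : ℕ) : ℤ)) • e i) = (fun _ : Site (d + 1) => (1 : (Matrix n n ℂ)ˣ)) y) ∧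
    gaugeAct (fun _ : Site (d + 1) => (1 : (Matrix n n ℂ)ˣ)) (flat (d := d + 1) (n := n))
      = vary (flat (d := d + 1) (n := n)) (fun (_ : Site (d + 1)) (_ : Fin (d + 1)) => (0 : Matrix n n ℂ)) 1 ∧
    IsPeriodicDir (fun (_ : Site (d + 1)) (_ : Fin (d + 1)) => (0 : Matrix n n ℂ)) ((L ^ (k + 1) * N : ℕ) : ℤ) ∧
    (∀ (y : Site (d + 1)) (κ : Fin (d + 1)), ‖(fun (_ : Site (d + 1)) (_ : Fin (d + 1)) => (0 : Matrix n n ℂ)) y κ‖ ≤ (0 : ℝ)) ∧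
    (∀ (y : Site (d + 1)) (κ τ : Fin (d + 1)),
      ‖(fun (_ : Site (d + 1)) (_ : Fin (d + 1)) => (0 : Matrix n n ℂ)) (y + e τ) κ
        - (fun (_ : Site (d + 1)) (_ : Fin (d + 1)) => (0 : Matrix n n ℂ)) y κ‖ ≤ (0 : ℝ)) := by
  refine ⟨isUnitaryCfg_flat, levelSmall_zero L k, smallField_flat_zero, fun φ hφ _ _ => dAction_eq_zero_of_flat isUnitaryCfg_flat smallField_flat_zero hφ _,
    cavgIter_flat L (k + 1), fun _ => (unitaryUnits _).one_mem, fun _ _ => rfl, ?_, isPeriodicDir_zero _, fun _ _ => by simp, fun _ _ _ => by simp⟩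
  rw [gaugeAct_one, vary_zero_dir]

/-! ## §2 All 31 binders at once: the END's conclusion instantiated -/

/-- **NON-VACUITY OF THE (APE) END AT THE TRIVIAL FLAT DATUM**: (155) `smallField_of_trivialLetters_final` APPLIED at `U = 1`, `x = δ = 0`, `u₀ = 1`,
`A₀ = 0`, `a₀ = a₁ = ω = 0`, `α₀ = α₁ = αh1 = 0` — every one of its binders (the ten of §1 and the 21 numeric lines, which at zero currencies read `0 ≤ 0`,
`0 ≤ 1`, `0 ≤ 1∕4`, `0 < 1`, `0 ≤ ρ₀²`) is met, so the hypothesis set is jointly satisfiable and the END is not vacuous.  The conclusion recorded is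
`…_final`'s radius at these values, token for token. [folklore] -/
theorem final_nonvacuous {n : Type} [Fintype n] [DecidableEq n] [Nonempty n] (hd : 1 ≤ d) {L : ℕ} (hL : 2 ≤ L) (N : ℕ) [NeZero N] (k : ℕ) :
    ∃ K : ℝ, 0 ≤ K ∧ SmallField (flat (d := d + 1) (n := n))
      ((K * (2 * (curl1C (d + 1) L / (1 - thetaLoc (d + 1) L * (((L : ℝ) ^ (k + 1)) ^ 2 * 0)))
                * (8 * (3 + 12 * ((d + 1 : ℕ) : ℝ)) * (2 + 2 * ((((d + 1 : ℕ) : ℝ) + 1) * L)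
                  * (1 + ((1250 * ((nbRad (d + 1) L : ℝ) + L) + 8 * (((d + 1 : ℕ) : ℝ) * L) + 2 * L)
                      * (((d + 1 : ℕ) : ℝ) * (2 * nbRad (d + 1) L + 1) ^ (d + 1))) / ((L : ℝ) / (L : ℝ) ^ (d + 1)))))
                * 0 * ((L : ℝ) ^ (k + 1) * 0)
              + (Fintype.card (T4AveragingDeficitWall.Plane (d + 1)) : ℝ)
                * (144 * (((L : ℝ) ^ (k + 1) * 0) * 0) + 5440 * ((L : ℝ) ^ (k + 1) * 0) ^ 3 + 8 * (0 * 0)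
                    + 304 * (0 * ((L : ℝ) ^ (k + 1) * 0) ^ 2) + 2688 * ((L : ℝ) ^ (k + 1) * 0) ^ 4))
          + Fintype.card n * (2 * (CdecD d * (((d : ℝ) + 1) * (2 * ((d : ℝ) + 1))
              * ((2 + 32 / (kappa163 (d + 1) / (d + 1)) ^ 2) * latticeConst (d + 1) (kappa163 (d + 1) / (d + 1) / 2)))))
            * (0 + 28 * ((3 + 12 * ((d + 1 : ℕ) : ℝ)) * ((L : ℝ) ^ (k + 1) * 0)
                  + 4 * (3 + 12 * ((d + 1 : ℕ) : ℝ)) ^ 3 / rho0 (d + 1) L ^ 2 * ((L : ℝ) ^ (k + 1) * 0) ^ 2) ^ 2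
                + 4 * (4 * (3 + 12 * ((d + 1 : ℕ) : ℝ)) ^ 3 / rho0 (d + 1) L ^ 2 * ((L : ℝ) ^ (k + 1) * 0) ^ 2))
          + 28 * ((L : ℝ) ^ (k + 1) * 0) ^ 2)
        / ((L : ℝ) ^ (k + 1)) ^ 2) := by
  obtain ⟨K, hK, h⟩ := smallField_of_trivialLetters_final (n := n) hd hL
  obtain ⟨hU, hs, hUx, hcrit, hTop, hu₀, hu₀P, hgauge₀, hA₀P, ha₀, ha₁⟩ := final_binders_at_flat (d := d) (n := n) L N k
  have hx : (0 : ℝ) ≤ 0 := le_rfl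
  have hUδ : SmallField (flat (d := d + 1) (n := n)) (0 / ((L : ℝ) ^ (k + 1)) ^ 2) := by rw [zero_div]; exact hUx
  have hδx : (0 : ℝ) / ((L : ℝ) ^ (k + 1)) ^ 2 ≤ 0 := by rw [zero_div]
  have hω' : (L : ℝ) ^ (k + 1) * (Real.exp 0 - 1)
      + 136 * ((((d + 1 : ℕ) : ℝ) + 1) * (((d + 1 : ℕ) : ℝ) + 4)) * (((L : ℝ) ^ (k + 1)) ^ 2 * (0 / ((L : ℝ) ^ (k + 1)) ^ 2)) ≤ (0 : ℝ) := by
    rw [Real.exp_zero, sub_self, mul_zero, zero_div, mul_zero, mul_zero, add_zero]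
  have hωd : 300 * ((d + 1 : ℕ) : ℝ) * (0 : ℝ) ≤ 1 := by rw [mul_zero]; exact zero_le_one
  have hβ : Real.exp 0 - 1 + 8 * (0 : ℝ) / (L : ℝ) ^ (k + 1) ≤ 1 / 4 := by rw [Real.exp_zero]; norm_num
  have hAα' : 2 * (Real.exp 0 - 1 + 8 * (0 : ℝ) / (L : ℝ) ^ (k + 1)) ≤ (0 : ℝ) := by rw [Real.exp_zero]; norm_num
  have hA1' : 4 / 3 * (Real.exp 0 * 0 + 2 * (8 * (0 : ℝ) / (L : ℝ) ^ (k + 1)) * (Real.exp 0 - 1)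
      + 165 * (0 : ℝ) / ((L : ℝ) ^ (k + 1)) ^ 2 + (8 * (0 : ℝ) / (L : ℝ) ^ (k + 1)) ^ 2) ≤ (0 : ℝ) := by rw [Real.exp_zero]; norm_num
  have hα₁h : (0 : ℝ) ≤ 0 / ((L : ℝ) ^ (k + 1)) ^ 2 := by rw [zero_div]
  have hθ : cruxC (d + 1) L * (((L : ℝ) ^ (k + 1)) ^ 2 * 0) < 1 := by rw [mul_zero, mul_zero]; exact one_pos
  have hθl : thetaLoc (d + 1) L * (((L : ℝ) ^ (k + 1)) ^ 2 * 0) < 1 := by rw [mul_zero, mul_zero]; exact one_pos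
  have hε : ((L : ℝ) ^ (k + 1)) ^ 2 * (0 : ℝ) ≤ 1 := by rw [mul_zero]; exact zero_le_one
  have hσ : 4 * (3 + 12 * ((d + 1 : ℕ) : ℝ)) ^ 2 * (L : ℝ) ^ (k + 1) * (0 : ℝ) ≤ rho0 (d + 1) L ^ 2 := by rw [mul_zero]; exact sq_nonneg _
  have hS1 : (8 * (3 + 12 * ((d + 1 : ℕ) : ℝ)) * (2 + 2 * ((((d + 1 : ℕ) : ℝ) + 1) * L)
      * (1 + ((1250 * ((nbRad (d + 1) L : ℝ) + L) + 8 * (((d + 1 : ℕ) : ℝ) * L) + 2 * L) * (((d + 1 : ℕ) : ℝ) * (2 * nbRad (d + 1) L + 1) ^ (d + 1)))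
          / ((L : ℝ) / (L : ℝ) ^ (d + 1))))) * ((L : ℝ) ^ (k + 1) * (0 : ℝ)) ≤ 1 := by rw [mul_zero, mul_zero]; exact zero_le_one
  have hb : 256 * (((d + 1 : ℕ) : ℝ) + 1) * L * (3 + 12 * ((d + 1 : ℕ) : ℝ)) * ((L : ℝ) ^ (k + 1) * (0 : ℝ)) ≤ 1 := by
    rw [mul_zero, mul_zero]; exact zero_le_one
  exact ⟨K, hK, h N k hU hx hs hUx hx hUδ hδx hcrit hTop hu₀ hu₀P hgauge₀ hA₀P ha₀ ha₁ hω' hωd hβ hAα' hA1' hα₁h hθ hθl hε hσ hS1 hb⟩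

/-! ## §3 The one Bałaban binder of G5, row NE3's `LandauRepB8`, at the flat pair -/

/-- **`LandauRepB8 L N j 1 1 1 0 0 0 β` HOLDS** (every level `j`, period `N`, exponent `β`): at the flat pair `(W, U_A) = (1, 1)` the trivial gauge `u = 1`
and the zero direction `Z = 0` give a unitary periodic gauge, a skew periodic direction, the representation `1^{1} = 1·e^{0}`, the Landau condition
(`isLandauB8_zero`), and the sup ∕ covariant-difference ∕ Hölder ∕ rough-Laplacian bounds with constants `s₁ = s₂ = 0` — so G5
`NE7ApeTrivialFlatEndLandauRep.smallField_of_landauRepB8`'s binder `hrep` is satisfiable together with all its other binders (§2) at `U = 1`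
(cf. row NE3's `pairLandauGaugeB8_flat`, the same instance inside the minimiser-pair quantifier prefix). [folklore] -/
theorem landauRepB8_flat_pair {n : Type} [Fintype n] [DecidableEq n] [Nonempty n] (L N j : ℕ) (β : ℝ) :
    LandauRepB8 L N j (flat (d := d + 1) (n := n)) (flat (d := d + 1) (n := n)) (fun _ : Site (d + 1) => (1 : (Matrix n n ℂ)ˣ))
      (fun (_ : Site (d + 1)) (_ : Fin (d + 1)) => (0 : Matrix n n ℂ)) 0 0 β :=
  { unitary := fun _ => (unitaryUnits _).one_mem
    periodic := fun _ _ => rfl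
    skew := fun _ _ => (skewAdjoint _).zero_mem
    per := fun _ _ _ => rfl
    rep := by rw [gaugeAct_one, vary_zero_dir]
    landau := isLandauB8_zero L N j _
    sup := fun x κ => by rw [norm_zero, zero_mul]
    grad := fun κ x μ => by simp only [Ad, mul_zero, zero_mul, sub_zero, norm_zero]; exact le_rfl
    holder := fun κ μ y => by simp only [Ad, mul_zero, zero_mul, sub_zero, norm_zero]; exact le_rfl
    lap := fun x κ => by rw [covLapDir_zero]; simp only [norm_zero, zero_mul]; exact le_rfl }

end

end Summit.QuantumFields.BalabanUV.T4Continuum.NE7ApeTrivialFlatEndWitness
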